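import Summits.QuantumAdvantage.QuantumAdvantage.Theorems.WalkFiniteStateNoPerfect

/-!
# A kernel-evaluable REFUTER for perfect finite-state strategies (planner qa-qnc0-p2 g21, ROUND-21 §6 (H); ask P2-21 (e),
# the decidable core; `--supports` crux `ManyReadersSqrtOdd` stmt-QuantumAdvantage-23109)

Prover seat qn-prover-3 g14.  The planner's characterisation of PERFECT strategies in `FinState2 5` (ROUND-21 §6 (H)) gives
necessary conditions that a small Boolean program can refute for each fixed `(n, c mod 3)`; this file defines the program and proves
it SOUND, the sibling `WalkFiniteStateSharp.lean` runs it for `12 ≤ n ≤ 37` and assembles the sharp `NoPerfectFinState2 5 12`.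

Fix a weight class `w (mod 5)`.  For a perfect strategy with tables `T g`:
* (constancy, from `fs2_step`) for every cut `1 ≤ g ≤ n−1` and weight `W ≡ w`, the bit
  `f(x) = T g x̄ w̄ ∧ live(c+g+W+x)` is constant on the reachable prefix counts `x ∈ [W − (n−g), min(g, W)]` — so the column
  `r ↦ T g r̄ w̄` passes the filter `colOK`; `offCheck g` verifies BY ENUMERATION OF ALL 32 COLUMNS that every column passing the
  filter has `f(min(g, W)) = false` for all `W ≡ w`, i.e. cut `g` never fires-live on the staircase inputs `1^W 0^{n−W}`;
* (end parity) on those inputs only the cuts `0` and `n` can then fire, with bits `b₀ = T 0 0 w̄`, `bₙ = T n w̄ w̄` and labels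
  `c + W`, `c + n + 2W`; `endCheck` verifies that for each of the four `(b₀, bₙ)` some `W ≡ w` has an EVEN fired-live count.
`fullCheck n c w = offCheck ∀ interior g ∧ endCheck`; **`exists_loser_of_fullCheck`**: `fullCheck n (c % 3) w = true` ⇒ every
`FinState2 5` strategy loses some input at charge `c` (`n ≥ 2`, `w < 5`).

WHAT THIS IS NOT: the evaluation itself (sibling file); nothing about polynomial strategies; separation NOT moved.
-/

open Finset

namespace Summit.QuantumAdvantage.AdviceFreeQNC0

namespace Coset21

/-! ### The program -/

/-- `allBelow k P = (∀ x < k, P x)` by structural recursion (short-circuits at the first failure). -/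
def allBelow : ℕ → (ℕ → Bool) → Bool
  | 0, _ => true
  | k + 1, P => allBelow k P && P k

/-- Liveness of cut `g` at weight `W` and prefix count `x`, charge `c`: `c + g + (W + x) ≢ 0 (mod 3)`. -/
def liveB (c g W x : ℕ) : Bool := decide ((c + g + (W + x)) % 3 ≠ 0)

/-- The fired-live bit of a column `col : Fin 5 → Bool` at prefix count `x`. -/
def fB (col : Fin 5 → Bool) (c g W x : ℕ) : Bool := col ⟨x % 5, Nat.mod_lt _ (by decide)⟩ && liveB c g W x

/-- All `32` columns `Fin 5 → Bool`. -/
def allCols : List (Fin 5 → Bool) := (List.range 32).map fun k => fun r => Nat.testBit k r.val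

/-- The constancy filter of cut `g` in class `w`: for every `W ≡ w (mod 5)`, `W ≤ n`, the fired-live bit is constant on the
reachable prefix counts `[W − (n − g), min g W]`. -/
def colOK (n c w : ℕ) (col : Fin 5 → Bool) (g : ℕ) : Bool :=
  allBelow (n + 1) fun W => decide (W % 5 ≠ w) ||
    allBelow (min g W) fun x => decide (x < W - (n - g)) || decide (fB col c g W (x + 1) = fB col c g W x)

/-- `offCheck`: every column passing the filter is OFF at the top reachable count `min g W` of every `W ≡ w`. -/
def offCheck (n c w g : ℕ) : Bool :=
  allCols.all fun col => !colOK n c w col g || allBelow (n + 1) fun W => decide (W % 5 ≠ w) || !fB col c g W (min g W)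

/-- `endCheck`: for each choice of the two end bits some `W ≡ w` has an even end count. -/
def endCheck (n c w : ℕ) : Bool :=
  [false, true].all fun b0 => [false, true].all fun bn =>
    !allBelow (n + 1) fun W => decide (W % 5 ≠ w) || ((b0 && liveB c 0 W 0) ^^ (bn && liveB c n W W))

/-- The refuter for `(n, c, w)`. -/
def fullCheck (n c w : ℕ) : Bool :=
  (allBelow n fun g => decide (g = 0) || offCheck n c w g) && endCheck n c w

/-! ### Semantics of the program -/

/-- `allBelow` is the bounded universal quantifier. -/
theorem allBelow_iff (k : ℕ) (P : ℕ → Bool) : allBelow k P = true ↔ ∀ x < k, P x = true := by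
  induction k with
  | zero => simp [allBelow]
  | succ k ih =>
    rw [allBelow, Bool.and_eq_true, ih]
    constructor
    · rintro ⟨h1, h2⟩ x hx
      rcases Nat.lt_succ_iff_lt_or_eq.1 hx with h | h
      · exact h1 x h
      · subst h; exact h2
    · intro h
      exact ⟨fun x hx => h x (Nat.lt_succ_of_lt hx), h k (Nat.lt_succ_self k)⟩

/-- Every column is enumerated. -/
theorem mem_allCols (col : Fin 5 → Bool) : col ∈ allCols := by
  revert col
  decide

/-- The column of cut `g` in class `w` read off a table. -/
def colOf {n : ℕ} (T : Fin (n + 1) → ZMod 5 → ZMod 5 → Bool) (g : Fin (n + 1)) (w : ℕ) : Fin 5 → Bool :=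
  fun r => T g ((r.val : ℕ) : ZMod 5) ((w : ℕ) : ZMod 5)

/-- The program's fired-live bit IS the strategy's fired-live bit (class `w`, any charge `c` via `c % 3`). -/
theorem fB_colOf_iff {n : ℕ} (T : Fin (n + 1) → ZMod 5 → ZMod 5 → Bool) (g : Fin (n + 1)) {w W : ℕ} (hw : w < 5)
    (hW : W % 5 = w) (c x : ℕ) :
    fB (colOf T g w) (c % 3) g.val W x = true ↔
      (T g ((x : ℕ) : ZMod 5) ((W : ℕ) : ZMod 5) = true ∧ (c + g.val + (W + x)) % 3 ≠ 0) := by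
  unfold fB colOf liveB
  rw [Bool.and_eq_true, decide_eq_true_eq]
  have hx : (((x % 5 : ℕ) : ℕ) : ZMod 5) = ((x : ℕ) : ZMod 5) := ZMod.natCast_mod x 5
  have hWw : ((W : ℕ) : ZMod 5) = ((w : ℕ) : ZMod 5) := by
    rw [ZMod.natCast_eq_natCast_iff', hW, Nat.mod_eq_of_lt hw]
  simp only [hx, hWw]
  constructor
  · rintro ⟨h1, h2⟩; exact ⟨h1, by omega⟩
  · rintro ⟨h1, h2⟩; exact ⟨h1, by omega⟩

/-! ### The staircase inputs `1^W 0^{n−W}` -/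

/-- The staircase input of weight `W`. -/
theorem wt_stair {n W : ℕ} (hW : W ≤ n) : wt (twoBlocks n 0 W W W) = W := by
  rw [wt_twoBlocks le_rfl le_rfl hW]; omega

/-- Its prefix counts are `min g W`. -/
theorem wtPrefix_stair {n W : ℕ} (hW : W ≤ n) (g : ℕ) (hg : g ≤ n) : wtPrefix (twoBlocks n 0 W W W) g = min g W := by
  rcases le_or_gt g W with h | h
  · rw [wtPrefix_twoBlocks_first h le_rfl hg, Nat.min_eq_left h]; omega
  · rw [wtPrefix_twoBlocks_right h.le h.le, wt_stair hW, Nat.min_eq_right h.le]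

/-! ### Soundness -/

/-- **The transposition step on the whole window** (general weight): for a perfect strategy, cut `g` (`1 ≤ g < n`), weight `W`
and prefix counts `x, x+1` both reachable (`W − (n−g) ≤ x`, `x + 1 ≤ min g W`), the fired-live bits at `x+1` and `x` agree. -/
theorem fs2_window {n : ℕ} (T : Fin (n + 1) → ZMod 5 → ZMod 5 → Bool) (c : ℕ) (y : Fin (n + 1) → (Fin n → Bool) → Bool)
    (hT : ∀ g u, y g u = T g ((wtPrefix u g.val : ℕ) : ZMod 5) ((wt u : ℕ) : ZMod 5))
    (hperf : ∀ u, ringWinU c y u = true) {g W x : ℕ} (hg1 : 1 ≤ g) (hgn : g < n)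
    (hlo : W ≤ x + (n - g)) (hhi : x + 1 ≤ min g W) :
    (T ⟨g, by omega⟩ ((x + 1 : ℕ) : ZMod 5) ((W : ℕ) : ZMod 5) = true ∧ (c + g + (W + (x + 1))) % 3 ≠ 0) ↔
      (T ⟨g, by omega⟩ ((x : ℕ) : ZMod 5) ((W : ℕ) : ZMod 5) = true ∧ (c + g + (W + x)) % 3 ≠ 0) := by
  have hxg : x + 1 ≤ g := le_trans hhi (Nat.min_le_left g W)
  have hxW : x + 1 ≤ W := le_trans hhi (Nat.min_le_right g W)
  set v := twoBlocks n (g - 1 - x) g (g + 1) (g + W - x) with hv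
  have hwt : wt v = W := by
    rw [hv, wt_twoBlocks (by omega) (by omega) (by omega)]; omega
  have hpre : wtPrefix v (g - 1) = x := by
    rw [hv, wtPrefix_twoBlocks_first (by omega) (by omega) (by omega)]; omega
  have hj : (⟨g, hgn⟩ : Fin n).val = (⟨g - 1, by omega⟩ : Fin n).val + 1 := by
    simp only; omega
  have h1 : v ⟨g - 1, by omega⟩ = true := by
    rw [hv]; unfold twoBlocks; rw [decide_eq_true_eq]; simp only; omega
  have h2 : v ⟨g, hgn⟩ = false := by
    rw [hv]; unfold twoBlocks; rw [decide_eq_false_iff_not]; simp only; omega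
  have key := fs2_step T c y hT hperf v ⟨g - 1, by omega⟩ ⟨g, hgn⟩ hj h1 h2
  simp only at key
  rw [hpre, hwt] at key
  have hg1' : g - 1 + 1 = g := by omega
  simp only [hg1'] at key
  exact key

/-- **The actual column passes the filter.** -/
theorem colOK_colOf {n : ℕ} (T : Fin (n + 1) → ZMod 5 → ZMod 5 → Bool) (c : ℕ) (y : Fin (n + 1) → (Fin n → Bool) → Bool)
    (hT : ∀ g u, y g u = T g ((wtPrefix u g.val : ℕ) : ZMod 5) ((wt u : ℕ) : ZMod 5))
    (hperf : ∀ u, ringWinU c y u = true) {w : ℕ} (hw : w < 5) {g : ℕ} (hg1 : 1 ≤ g) (hgn : g < n) :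
    colOK n (c % 3) w (colOf T ⟨g, by omega⟩ w) g = true := by
  rw [colOK, allBelow_iff]
  intro W hW
  rw [Bool.or_eq_true, decide_eq_true_eq]
  by_cases hWw : W % 5 = w
  · right
    rw [allBelow_iff]
    intro x hx
    rw [Bool.or_eq_true, decide_eq_true_eq, decide_eq_true_eq]
    by_cases hlo : x < W - (n - g)
    · exact Or.inl hlo
    · right
      rw [Bool.eq_iff_iff, fB_colOf_iff T _ hw hWw, fB_colOf_iff T _ hw hWw]
      exact fs2_window T c y hT hperf hg1 hgn (by omega) (by omega)
  · exact Or.inl hWw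

/-- **Interior cuts are off on the staircase inputs** when `offCheck` passes. -/
theorem interior_off {n : ℕ} (T : Fin (n + 1) → ZMod 5 → ZMod 5 → Bool) (c : ℕ) (y : Fin (n + 1) → (Fin n → Bool) → Bool)
    (hT : ∀ g u, y g u = T g ((wtPrefix u g.val : ℕ) : ZMod 5) ((wt u : ℕ) : ZMod 5))
    (hperf : ∀ u, ringWinU c y u = true) {w : ℕ} (hw : w < 5) (g : Fin (n + 1)) (hg1 : 1 ≤ g.val) (hgn : g.val < n)
    (hoff : offCheck n (c % 3) w g.val = true) {W : ℕ} (hWn : W ≤ n) (hWw : W % 5 = w) :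
    ¬ (y g (twoBlocks n 0 W W W) = true ∧ (c + g.val + walkExp (twoBlocks n 0 W W W) g.val) % 3 ≠ 0) := by
  rw [offCheck, List.all_eq_true] at hoff
  have h := hoff (colOf T g w) (mem_allCols _)
  have hgeq : (⟨g.val, by omega⟩ : Fin (n + 1)) = g := Fin.ext rfl
  have hOK := colOK_colOf T c y hT hperf hw hg1 hgn
  rw [hgeq] at hOK
  rw [hOK, Bool.not_true, Bool.false_or, allBelow_iff] at h
  have hWf := h W (by omega)
  rw [Bool.or_eq_true, decide_eq_true_eq, Bool.not_eq_true'] at hWf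
  rcases hWf with hne | hfalse
  · exact absurd hWw hne
  · intro hfired
    rw [hT g, wtPrefix_stair hWn g.val (by omega), wt_stair hWn] at hfired
    unfold walkExp at hfired
    rw [wt_stair hWn, wtPrefix_stair hWn g.val (by omega)] at hfired
    have := (fB_colOf_iff T g hw hWw c (min g.val W)).2 hfired
    rw [hfalse] at this
    exact Bool.false_ne_true this

/-- **SOUNDNESS of the refuter**: if `fullCheck n (c % 3) w` passes then every `FinState2 5` strategy loses some input at charge
`c` (`n ≥ 2`, `w < 5`). -/
theorem exists_loser_of_fullCheck {n : ℕ} (hn : 2 ≤ n) (c : ℕ) {w : ℕ} (hw : w < 5) (hc : fullCheck n (c % 3) w = true)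
    (y : Fin (n + 1) → (Fin n → Bool) → Bool) (hy : FinState2 5 y) : ∃ u, ringWinU c y u = false := by
  classical
  obtain ⟨T, hT⟩ := hy
  by_contra hno
  push Not at hno
  have hperf : ∀ u, ringWinU c y u = true := by
    intro u
    cases h : ringWinU c y u
    · exact absurd h (hno u)
    · rfl
  rw [fullCheck, Bool.and_eq_true, allBelow_iff] at hc
  obtain ⟨hoff, hend⟩ := hc
  -- the two end bits
  set b0 := T 0 0 ((w : ℕ) : ZMod 5) with hb0
  set bn := T (Fin.last n) ((w : ℕ) : ZMod 5) ((w : ℕ) : ZMod 5) with hbn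
  -- endCheck hands us a weight `W ≡ w` with an EVEN end count for (b0, bn)
  rw [endCheck, List.all_eq_true] at hend
  have h1 := hend b0 (by cases b0 <;> simp)
  rw [List.all_eq_true] at h1
  have h2 := h1 bn (by cases bn <;> simp)
  rw [Bool.not_eq_true', ← Bool.not_eq_true, allBelow_iff] at h2
  push Not at h2
  obtain ⟨W, hWlt, hWbad⟩ := h2
  have hWbad' : (decide (W % 5 ≠ w) || ((b0 && liveB (c % 3) 0 W 0) ^^ (bn && liveB (c % 3) n W W))) = false :=
    Bool.eq_false_iff.mpr hWbad
  rw [Bool.or_eq_false_iff, decide_eq_false_iff_not, not_not] at hWbad'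
  obtain ⟨hWw, hxor⟩ := hWbad'
  have hWn : W ≤ n := by omega
  -- the fired-live set of the staircase input of weight W sits inside {0, last}
  set u := twoBlocks n 0 W W W with hu
  set A := (univ : Finset (Fin (n + 1))).filter fun g => y g u = true ∧ (c + g.val + walkExp u g.val) % 3 ≠ 0 with hA
  have hAodd : A.card % 2 = 1 := by
    have h := hperf u; unfold ringWinU at h; rw [decide_eq_true_eq] at h; exact h
  have hsub : A = (({0, Fin.last n} : Finset (Fin (n + 1))).filter fun g => g ∈ A) := by
    ext g
    constructor
    · intro hg
      rw [mem_filter, mem_insert, mem_singleton]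
      refine ⟨?_, hg⟩
      by_contra hne
      push Not at hne
      have hg1 : 1 ≤ g.val := by
        rw [Nat.one_le_iff_ne_zero]; intro h0; exact hne.1 (Fin.ext h0)
      have hgn : g.val < n := by
        have := g.isLt
        have hne' : g.val ≠ n := fun h => hne.2 (Fin.ext (by rw [h]; rfl))
        omega
      have hoffg := hoff g.val hgn
      rw [Bool.or_eq_true, decide_eq_true_eq] at hoffg
      rcases hoffg with h0 | hoffg
      · omega
      · rw [hA, mem_filter] at hg
        exact interior_off T c y hT hperf hw g hg1 hgn hoffg hWn hWw hg.2
    · intro h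
      rw [mem_filter] at h
      exact h.2
  -- membership of the two ends
  have h0n : (0 : Fin (n + 1)) ≠ Fin.last n := by
    intro h; have := congrArg Fin.val h; simp at this; omega
  have hmem0 : (0 : Fin (n + 1)) ∈ A ↔ (b0 && liveB (c % 3) 0 W 0) = true := by
    rw [hA, mem_filter, hT 0 u, hu]
    unfold walkExp
    rw [wt_stair hWn, show (0 : Fin (n + 1)).val = 0 from rfl, wtPrefix_stair hWn 0 (by omega), Nat.zero_min,
      Nat.cast_zero, hb0]
    unfold liveB
    rw [Bool.and_eq_true, decide_eq_true_eq]
    have hWw' : ((W : ℕ) : ZMod 5) = ((w : ℕ) : ZMod 5) := by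
      rw [ZMod.natCast_eq_natCast_iff', hWw, Nat.mod_eq_of_lt hw]
    simp only [mem_univ, true_and, hWw']
    constructor
    · rintro ⟨h1, h2⟩; exact ⟨h1, by omega⟩
    · rintro ⟨h1, h2⟩; exact ⟨h1, by omega⟩
  have hmemn : Fin.last n ∈ A ↔ (bn && liveB (c % 3) n W W) = true := by
    rw [hA, mem_filter, hT (Fin.last n) u, hu]
    unfold walkExp
    rw [wt_stair hWn, Fin.val_last, wtPrefix_stair hWn n le_rfl, Nat.min_eq_right hWn, hbn]
    unfold liveB
    rw [Bool.and_eq_true, decide_eq_true_eq]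
    have hWw' : ((W : ℕ) : ZMod 5) = ((w : ℕ) : ZMod 5) := by
      rw [ZMod.natCast_eq_natCast_iff', hWw, Nat.mod_eq_of_lt hw]
    simp only [mem_univ, true_and, hWw']
    constructor
    · rintro ⟨h1, h2⟩; exact ⟨h1, by omega⟩
    · rintro ⟨h1, h2⟩; exact ⟨h1, by omega⟩
  -- count: |A| = [0 ∈ A] + [last ∈ A] is odd, but endCheck says the two end bits have even sum
  by_cases hz : (0 : Fin (n + 1)) ∈ A <;> by_cases hl : Fin.last n ∈ A
  · have h2 : A.card = 2 := by
      rw [hsub, filter_insert, if_pos hz, filter_singleton, if_pos hl, card_insert_of_notMem, card_singleton]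
      rw [mem_singleton]; exact h0n
    omega
  · have e0 := hmem0.1 hz
    have en : (bn && liveB (c % 3) n W W) = false := Bool.eq_false_iff.mpr fun h => hl (hmemn.2 h)
    rw [e0, en] at hxor
    exact absurd hxor (by decide)
  · have e0 : (b0 && liveB (c % 3) 0 W 0) = false := Bool.eq_false_iff.mpr fun h => hz (hmem0.2 h)
    have en := hmemn.1 hl
    rw [e0, en] at hxor
    exact absurd hxor (by decide)
  · have h0 : A.card = 0 := by
      rw [hsub, filter_insert, if_neg hz, filter_singleton, if_neg hl, card_empty]
    omega

end Coset21

end Summit.QuantumAdvantage.AdviceFreeQNC0
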